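import Summits.HodgeConjecture.HodgeConjecture.Theorems.K2E1bDSCellData            -- ★ (row U8-3, DATA half): `spanDplus∕spanJplus∕spanDminus`, `dsCellD∕Dplus∕Dminus`, `dsCellDatum`, `mem_dsCellDatum_S_iff`, `*_mem_sqSet_iff`
import Literature.RepresentationTheory.Kovacevic2021.SU21CasimirCentral               -- ★ `casimir_eq_smul_one`, `casimir_vec_reduced` (Casimir as an OPERATOR)
import HarnessLib

/-!
# K2 ∕ E1b unit U8, row U8-3 (LAWS half) `K2E1bDSCellDataLaws`: vertices, strong connectivity, irreducibility, Casimir, integrality and square-completeness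
# of the Kovačević cell data `dsCellDatum j a b c` of the discrete-series packet `Π(φ(a,b,c)) = {D_φ, D_φ⁺, D_φ⁻}` of `U(2,1)`

HCML Track B «K2-LIT», cell `hodgecm-mathlib`, crux H413 = stmt-HodgeConjecture-24833 (supports-only helper; closes nothing by itself).  Second half of row U8-3
(DEAL SPEC Q4, K2E1b-plan (g2) 2026-09-04T00:32:32Z ∕ 00:42:43Z; hand K2E4-p10 (g2)); the DATA half is ★ `Theorems/K2E1bDSCellData.lean` (spans, cells,
`dsCellDatum`, `K`-type sets in cone coordinates) — split only because a `Theorems/` file with proofs is ≤ 400 lines.  PROVED here, for `IsRegularParam a b c`: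
* §1 two small complements to ★ `SU21CasimirCentral`∕`SU21Casimir`: the Casimir SCALAR of a datum with scalar Casimir, and of `V(c,2t)` (`= 4c + 2t²∕3`);
* §2 the BLATTNER VERTICES `D_φ (a−c+1, a+c−2b)` (a local minimum; all of `S` in the cone above it), `D_φ⁺ (a−b, a+b−2c+3)`, `D_φ⁻ (b−c, b+c−2a−3)` as `K`-types with
  their two outward neighbours absent; the CONE VERTICES `(1, 2t^±)` of `D_φ^±` (the `x₀` of ★ `isUnitarizable_of_products_nonpos`); SQUARE-COMPLETENESS of the
  three `K`-type sets (its `hsq`); non-emptiness;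
* §3 STRONG CONNECTIVITY (★ `subquotient_principalSeries_reach`) ⇒ IRREDUCIBILITY (★ `isIrreducible_of_forall_reach`) of each cell datum; the Casimir SCALAR
  `κ₀ = casimirOf − centralOf²∕3` on every `K`-type and the Casimir OPERATOR `= κ₀ • 1` (★ `casimir_principalSeries`, `subquotient_casimirScalar`,
  `casimir_eq_smul_one`, U8c `casimir_plus∕minus`); INTEGRALITY `6 ∣ m − 3n + 3 + 2e` of the tier-1 twist (U8c `twist_integral_*`).
Row U8-4 feeds these to ★ `kTypeRepTw` (twist) and ★ `isUnitarizable_of_products_nonpos` (unitarity).  No definition, no `sorry`, no named `Prop` fact, no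
instance (one `attribute [local instance] LieRing.ofAssociativeRing`, the Mathlib idiom of every ★ Kovačević file), no notation.

Sources: [Kovacevic2021] §3 Thm 1–3, Remarks 2, 3, 6, §4 Thm 4; [BorelWallach2000] VI §4 4.7–4.10; [Rogawski1990] §12.3 pp. 176–178.  HONEST LABEL: HC_CM is proved
only modulo the 7 printed citations (2 remaining named inputs: hLiu418 = stmt-HodgeConjecture-24832, h413 = stmt-HodgeConjecture-24833) until rung 0 closes.
-/

set_option autoImplicit false
set_option linter.dupNamespace false

noncomputable section

namespace Summit.HodgeConjecture.HodgeConjecture.Cruxes.H413.K2E1bDSCellData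

open Literature.RepresentationTheory.Kovacevic2021 Literature.RepresentationTheory.Kovacevic2021.SU21Datum
open Literature.RepresentationTheory.Kovacevic2021.SU21Datum.PrincipalSeries
open Summit.HodgeConjecture.HodgeConjecture.Cruxes.H413.K2E1bGKCohomologyU21.U8 (IsRegularParam casimirOf centralOf)
open Summit.HodgeConjecture.HodgeConjecture.Cruxes.H413.K2E1bGKCohomologyU21.U8.LevelB

-- Mathlib idiom (Mathlib/Algebra/Lie/OfAssociative.lean): commutator brackets on associative algebras; needed for the `𝔤𝔩(3,ℂ)`-module
-- structure on `𝒟.V` (Lie submodules of `V(c,2t)`), exactly as in every ★ `Kovacevic2021` file and ★ `K2E1bDsDatum`.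
attribute [local instance 100] LieRing.ofAssociativeRing

/-! ## §1 The Casimir SCALAR of a datum with scalar Casimir, and of `V(c,2t)` (two small complements to ★ `SU21CasimirCentral`) -/

/-- The Casimir scalar of a datum whose Casimir operator is the scalar `κ` is `κ` on every `K`-type (`Ω u^1_{n,m} = c_{n,m} u^1_{n,m}`, ★ `casimir_vec`).
[cite: Kovacevic2021, §3 Thm 1] [cite: BorelWallach2000, II §2.5] -/
theorem casimirScalar_eq_of_casimir_eq_smul {𝒟 : SU21Datum} {κ : ℂ} (h : 𝒟.casimir = κ • (1 : Module.End ℂ 𝒟.V)) {n m : ℤ}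
    (hS : (n, m) ∈ 𝒟.S) : 𝒟.casimirScalar n m = κ := by
  have h1 := 𝒟.casimir_vec hS le_rfl (𝒟.one_le_of_mem hS)
  rw [h, LinearMap.smul_apply, Module.End.one_apply] at h1
  exact (smul_left_injective ℂ (𝒟.vec_ne_zero ⟨hS, le_rfl, 𝒟.one_le_of_mem hS⟩) h1).symm

/-- The Casimir scalar of `V(c,2t)` on each of its `K`-types is `4c + 2t²∕3` (★ `casimir_principalSeries`). [cite: Kovacevic2021, §3 Thm 3, Remark 3] -/
theorem principalSeries_casimirScalar (c : ℂ) (t : ℤ) {n m : ℤ} (hS : (n, m) ∈ (principalSeries c t).S) :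
    (principalSeries c t).casimirScalar n m = 4 * c + 2 * (t : ℂ) ^ 2 / 3 :=
  casimirScalar_eq_of_casimir_eq_smul (casimir_principalSeries c t) hS


section Regular

variable {a b c : ℤ}

/-! ## §2 Blattner vertices, cone vertices, square-completeness, non-emptiness -/

/-- **Vertex of `D_φ`**: `(a−c+1, a+c−2b)` (cone corner `p = 0, q = a−c`) is a `K`-type of `dsCellDatum 0` and a LOCAL MINIMUM — no `K`-type at either lower
neighbour `(n−1, m−3)`, `(n−1, m+3)` — so every `K`-type of `D_φ` lies in the cone `n − (a−c+1) ≥ |m − (a+c−2b)|∕3` above it (★ `cone_of_isLocalMin`).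
[cite: BorelWallach2000, VI §4 4.10] [cite: Rogawski1990, §12.3 p. 177] -/
theorem dsCellDatum_vertex_zero (h : IsRegularParam a b c) :
    ((a - c + 1, a + c - 2 * b) : ℤ × ℤ) ∈ (dsCellDatum 0 a b c).S ∧
      ((a - c + 1 - 1, a + c - 2 * b - 3) : ℤ × ℤ) ∉ (dsCellDatum 0 a b c).S ∧
      ((a - c + 1 - 1, a + c - 2 * b + 3) : ℤ × ℤ) ∉ (dsCellDatum 0 a b c).S ∧
      ∀ y ∈ (dsCellDatum 0 a b c).S, 3 * (a - c + 1) + (a + c - 2 * b) ≤ 3 * y.1 + y.2 ∧ 3 * (a - c + 1) - (a + c - 2 * b) ≤ 3 * y.1 - y.2 := by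
  have hS := fun n m => (mem_dsCellDatum_S_iff h n m).1
  have hv : ((a - c + 1, a + c - 2 * b) : ℤ × ℤ) ∈ (dsCellDatum 0 a b c).S :=
    (hS _ _).2 ⟨0, a - c, le_rfl, by obtain ⟨h1, h2⟩ := h; omega, by ring, by simp only [tPlus]; ring, le_rfl⟩
  have hD : ((a - c + 1 - 1, a + c - 2 * b - 3) : ℤ × ℤ) ∉ (dsCellDatum 0 a b c).S := by
    rintro hx; obtain ⟨p, q, hp, hq, h3, h4, h5⟩ := (hS _ _).1 hx; simp only [tPlus] at h4; omega
  have hC : ((a - c + 1 - 1, a + c - 2 * b + 3) : ℤ × ℤ) ∉ (dsCellDatum 0 a b c).S := by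
    rintro hx; obtain ⟨p, q, hp, hq, h3, h4, h5⟩ := (hS _ _).1 hx; simp only [tPlus] at h4; omega
  refine ⟨hv, hD, hC, ?_⟩
  rintro ⟨y₁, y₂⟩ hy
  obtain ⟨p, q, hp, hq, h3, h4, h5⟩ := (hS y₁ y₂).1 hy
  simp only [tPlus] at h4
  constructor <;> omega

/-- **Blattner vertex of `D_φ⁺`**: `(a−b, a+b−2c+3)` (cone corner `p = 0, q = a−b−1`) is a `K`-type of `dsCellDatum 1`, with NO `K`-type at `(n−1, m−3)` (`p−1 < 0`)
and NONE at `(n+1, m−3)` (`q = a−b` is beyond the root line) — the corner of the strip `[0,∞)×[0,a−b−1]`. [cite: BorelWallach2000, VI §4 4.10] [cite: Rogawski1990, §12.3 p. 177] -/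
theorem dsCellDatum_vertex_one (h : IsRegularParam a b c) :
    ((a - b, a + b - 2 * c + 3) : ℤ × ℤ) ∈ (dsCellDatum 1 a b c).S ∧
      ((a - b - 1, a + b - 2 * c + 3 - 3) : ℤ × ℤ) ∉ (dsCellDatum 1 a b c).S ∧
      ((a - b + 1, a + b - 2 * c + 3 - 3) : ℤ × ℤ) ∉ (dsCellDatum 1 a b c).S := by
  have hS := fun n m => (mem_dsCellDatum_S_iff h n m).2.1
  refine ⟨(hS _ _).2 ⟨0, a - b - 1, le_rfl, by obtain ⟨h1, h2⟩ := h; omega, by ring, by simp only [tPlus]; ring, le_rfl⟩, ?_, ?_⟩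
  · rintro hx; obtain ⟨p, q, hp, hq, h3, h4, h5⟩ := (hS _ _).1 hx; simp only [tPlus] at h4; omega
  · rintro hx; obtain ⟨p, q, hp, hq, h3, h4, h5⟩ := (hS _ _).1 hx; simp only [tPlus] at h4; omega

/-- **Blattner vertex of `D_φ⁻`**: `(b−c, b+c−2a−3)` (cone corner `p = b−c−1, q = 0`) is a `K`-type of `dsCellDatum 2`, with NO `K`-type at `(n−1, m+3)` (`q−1 < 0`)
and NONE at `(n+1, m+3)` (`p = b−c` is beyond the root line) — the corner of the strip `[0,b−c−1]×[0,∞)`. [cite: BorelWallach2000, VI §4 4.10] [cite: Rogawski1990, §12.3 p. 177] -/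
theorem dsCellDatum_vertex_two (h : IsRegularParam a b c) :
    ((b - c, b + c - 2 * a - 3) : ℤ × ℤ) ∈ (dsCellDatum 2 a b c).S ∧
      ((b - c - 1, b + c - 2 * a - 3 + 3) : ℤ × ℤ) ∉ (dsCellDatum 2 a b c).S ∧
      ((b - c + 1, b + c - 2 * a - 3 + 3) : ℤ × ℤ) ∉ (dsCellDatum 2 a b c).S := by
  have hS := fun n m => (mem_dsCellDatum_S_iff h n m).2.2
  refine ⟨(hS _ _).2 ⟨b - c - 1, 0, by obtain ⟨h1, h2⟩ := h; omega, le_rfl, by ring, by simp only [tMinus]; ring, le_rfl⟩, ?_, ?_⟩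
  · rintro hx; obtain ⟨p, q, hp, hq, h3, h4, h5⟩ := (hS _ _).1 hx; simp only [tMinus] at h4; omega
  · rintro hx; obtain ⟨p, q, hp, hq, h3, h4, h5⟩ := (hS _ _).1 hx; simp only [tMinus] at h4; omega

/-- **Cone vertex of `D_φ⁺`'s datum** (the LOCAL MINIMUM in the sense of ★ `SU21VertexRigidity` ∕ the `x₀` of ★ `isUnitarizable_of_products_nonpos`, NOT the Blattner
corner): `(1, 2t⁺)` (cone point `p = q = 0`) is a `K`-type and neither `(0, 2t⁺ − 3)` nor `(0, 2t⁺ + 3)` is (no `K`-type has `n = 0`).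
[cite: Kovacevic2021, §3 Thm 3, §4 Thm 4] -/
theorem dsCellDatum_coneVertex_one (h : IsRegularParam a b c) :
    ((1, 2 * tPlus a b c) : ℤ × ℤ) ∈ (dsCellDatum 1 a b c).S ∧
      ((1 - 1, 2 * tPlus a b c - 3) : ℤ × ℤ) ∉ (dsCellDatum 1 a b c).S ∧ ((1 - 1, 2 * tPlus a b c + 3) : ℤ × ℤ) ∉ (dsCellDatum 1 a b c).S := by
  have hS := fun n m => (mem_dsCellDatum_S_iff h n m).2.1
  refine ⟨(hS _ _).2 ⟨0, 0, le_rfl, le_rfl, by ring, by ring, by obtain ⟨h1, h2⟩ := h; omega⟩, ?_, ?_⟩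
  · rintro hx; obtain ⟨p, q, hp, hq, h3, -, -⟩ := (hS _ _).1 hx; omega
  · rintro hx; obtain ⟨p, q, hp, hq, h3, -, -⟩ := (hS _ _).1 hx; omega

/-- **Cone vertex of `D_φ⁻`'s datum**: `(1, 2t⁻)` is a `K`-type, `(0, 2t⁻ ∓ 3)` are not. [cite: Kovacevic2021, §3 Thm 3, §4 Thm 4] -/
theorem dsCellDatum_coneVertex_two (h : IsRegularParam a b c) :
    ((1, 2 * tMinus a b c) : ℤ × ℤ) ∈ (dsCellDatum 2 a b c).S ∧
      ((1 - 1, 2 * tMinus a b c - 3) : ℤ × ℤ) ∉ (dsCellDatum 2 a b c).S ∧ ((1 - 1, 2 * tMinus a b c + 3) : ℤ × ℤ) ∉ (dsCellDatum 2 a b c).S := by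
  have hS := fun n m => (mem_dsCellDatum_S_iff h n m).2.2
  refine ⟨(hS _ _).2 ⟨0, 0, le_rfl, le_rfl, by ring, by ring, by obtain ⟨h1, h2⟩ := h; omega⟩, ?_, ?_⟩
  · rintro hx; obtain ⟨p, q, hp, hq, h3, -, -⟩ := (hS _ _).1 hx; omega
  · rintro hx; obtain ⟨p, q, hp, hq, h3, -, -⟩ := (hS _ _).1 hx; omega

/-- **The `K`-type sets of the cells are SQUARE-COMPLETE** (hypothesis `hsq` of ★ `isUnitarizable_of_products_nonpos`): if `(n, m−3)`, `(n, m+3)` are `K`-types then so is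
`(n−1, m)` (product cells: `(p, q+1)`, `(p+1, q)` in the cell force `(p, q)` in the cell). [cite: Kovacevic2021, §4 Thm 4] -/
theorem dsCellDatum_square (h : IsRegularParam a b c) (j : Fin 3) (n m : ℤ) (h₁ : (n, m - 3) ∈ (dsCellDatum j a b c).S)
    (h₂ : (n, m + 3) ∈ (dsCellDatum j a b c).S) : (n - 1, m) ∈ (dsCellDatum j a b c).S := by
  fin_cases j
  · have hS := fun n m => (mem_dsCellDatum_S_iff h n m).1
    obtain ⟨p₁, q₁, hp₁, hq₁, e₁, f₁, c₁⟩ := (hS _ _).1 h₁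
    obtain ⟨p₂, q₂, hp₂, hq₂, e₂, f₂, c₂⟩ := (hS _ _).1 h₂
    exact (hS _ _).2 ⟨p₁, q₂, hp₁, hq₂, by omega, by omega, c₂⟩
  · have hS := fun n m => (mem_dsCellDatum_S_iff h n m).2.1
    obtain ⟨p₁, q₁, hp₁, hq₁, e₁, f₁, c₁⟩ := (hS _ _).1 h₁
    obtain ⟨p₂, q₂, hp₂, hq₂, e₂, f₂, c₂⟩ := (hS _ _).1 h₂
    exact (hS _ _).2 ⟨p₁, q₂, hp₁, hq₂, by omega, by omega, c₂⟩
  · have hS := fun n m => (mem_dsCellDatum_S_iff h n m).2.2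
    obtain ⟨p₁, q₁, hp₁, hq₁, e₁, f₁, c₁⟩ := (hS _ _).1 h₁
    obtain ⟨p₂, q₂, hp₂, hq₂, e₂, f₂, c₂⟩ := (hS _ _).1 h₂
    exact (hS _ _).2 ⟨p₁, q₂, hp₁, hq₂, by omega, by omega, c₁⟩

/-- The cells are non-empty (their vertices are `K`-types). [cite: BorelWallach2000, VI §4 4.10] -/
theorem dsCellDatum_S_nonempty (h : IsRegularParam a b c) (j : Fin 3) : (dsCellDatum j a b c).S.Nonempty := by
  fin_cases j
  · exact ⟨_, (dsCellDatum_vertex_zero h).1⟩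
  · exact ⟨_, (dsCellDatum_vertex_one h).1⟩
  · exact ⟨_, (dsCellDatum_vertex_two h).1⟩

/-! ## §3 Strong connectivity, irreducibility, Casimir scalar and operator, integrality -/

/-- **`D_φ`'s datum is strongly connected** (the quadrant has no internal root line). [cite: Kovacevic2021, §3 proof of Thm 3, Remark 6] -/
theorem dsCellD_reach (h : IsRegularParam a b c) :
    ∀ x ∈ (dsCellD a b c).S, ∀ y ∈ (dsCellD a b c).S, (dsCellD a b c).Reach x y := by
  obtain ⟨h1, h2⟩ := h
  exact subquotient_principalSeries_reach Set.ordConnected_Ici Set.ordConnected_Ici (fun p hp => by simpa only [Set.mem_Ici] using hp)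
    (fun q hq => by simp only [Set.mem_Ici] at hq; omega) (fun p q hp hq => dsCellD_mem_sqSet_iff ⟨h1, h2⟩ hp hq)
    (fun p hp _ => acoef_plus_ne_zero (by omega) (by omega) (by simpa only [Set.mem_Ici] using hp))
    (fun q hq _ => by rw [Set.mem_Ici] at hq; rw [Ne, bcoef_plus_eq_zero_iff]; omega)

/-- **`D_φ⁺`'s datum is strongly connected** (the strip `q ≤ a−b−1` has no internal root line). [cite: Kovacevic2021, §3 proof of Thm 3, Remark 6] -/
theorem dsCellDplus_reach (h : IsRegularParam a b c) :
    ∀ x ∈ (dsCellDplus a b c).S, ∀ y ∈ (dsCellDplus a b c).S, (dsCellDplus a b c).Reach x y := by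
  obtain ⟨h1, h2⟩ := h
  exact subquotient_principalSeries_reach Set.ordConnected_Ici Set.ordConnected_Icc (fun p hp => by simpa only [Set.mem_Ici] using hp)
    (fun q hq => (Set.mem_Icc.1 hq).1) (fun p q hp hq => dsCellDplus_mem_sqSet_iff ⟨h1, h2⟩ hp hq)
    (fun p hp _ => acoef_plus_ne_zero (by omega) (by omega) (by simpa only [Set.mem_Ici] using hp))
    (fun q hq hq1 => by rw [Set.mem_Icc] at hq hq1; rw [Ne, bcoef_plus_eq_zero_iff]; omega)

/-- **`D_φ⁻`'s datum is strongly connected** (the strip `p ≤ b−c−1` has no internal root line). [cite: Kovacevic2021, §3 proof of Thm 3, Remark 6] -/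
theorem dsCellDminus_reach (h : IsRegularParam a b c) :
    ∀ x ∈ (dsCellDminus a b c).S, ∀ y ∈ (dsCellDminus a b c).S, (dsCellDminus a b c).Reach x y := by
  obtain ⟨h1, h2⟩ := h
  exact subquotient_principalSeries_reach Set.ordConnected_Icc Set.ordConnected_Ici (fun p hp => (Set.mem_Icc.1 hp).1)
    (fun q hq => by simpa only [Set.mem_Ici] using hq) (fun p q hp hq => dsCellDminus_mem_sqSet_iff ⟨h1, h2⟩ hp hq)
    (fun p hp hp1 => by rw [Set.mem_Icc] at hp hp1; rw [Ne, acoef_minus_eq_zero_iff]; omega)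
    (fun q hq _ => bcoef_minus_ne_zero (by omega) (by omega) (by simpa only [Set.mem_Ici] using hq))

/-- **Each cell datum is strongly connected.** [cite: Kovacevic2021, §3 proof of Thm 3, Remark 6] -/
theorem dsCellDatum_reach (h : IsRegularParam a b c) (j : Fin 3) :
    ∀ x ∈ (dsCellDatum j a b c).S, ∀ y ∈ (dsCellDatum j a b c).S, (dsCellDatum j a b c).Reach x y := by
  fin_cases j
  · exact dsCellD_reach h
  · exact dsCellDplus_reach h
  · exact dsCellDminus_reach h

/-- **Each cell datum is IRREDUCIBLE** as a `𝔤𝔩(3,ℂ)`-module (strongly connected with a `K`-type, ★ `isIrreducible_of_forall_reach`) — the three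
composition factors `D_φ, D_φ⁺, D_φ⁻` of the two principal series. [cite: Kovacevic2021, §3 Thm 2, Remark 2, Remark 6] [cite: BorelWallach2000, VI §4 4.10] -/
theorem dsCellDatum_isIrreducible (h : IsRegularParam a b c) (j : Fin 3) :
    LieModule.IsIrreducible ℂ (Matrix (Fin 3) (Fin 3) ℂ) (dsCellDatum j a b c).V :=
  isIrreducible_of_forall_reach (dsCellDatum_S_nonempty h j) (dsCellDatum_reach h j)

/-- Casimir scalar of `D_φ`'s datum on its `K`-types: `κ − e²∕3` (★ `subquotient_casimirScalar`, `principalSeries_casimirScalar`, ★ `casimir_plus`).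
[cite: Kovacevic2021, §3 Remark 3] -/
theorem dsCellD_casimirScalar {n m : ℤ} (hS : (n, m) ∈ (dsCellD a b c).S) :
    (dsCellD a b c).casimirScalar n m = (casimirOf a b c : ℂ) - ((centralOf a b c : ℤ) : ℂ) ^ 2 / 3 := by
  rw [dsCellD, subquotient_S] at hS
  rw [dsCellD, subquotient_casimirScalar hS, principalSeries_casimirScalar _ _ hS.1, casimir_plus]

/-- Casimir scalar of `D_φ⁺`'s datum on its `K`-types: `κ − e²∕3`. [cite: Kovacevic2021, §3 Remark 3] -/
theorem dsCellDplus_casimirScalar {n m : ℤ} (hS : (n, m) ∈ (dsCellDplus a b c).S) :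
    (dsCellDplus a b c).casimirScalar n m = (casimirOf a b c : ℂ) - ((centralOf a b c : ℤ) : ℂ) ^ 2 / 3 := by
  rw [dsCellDplus, subquotient_S] at hS
  rw [dsCellDplus, subquotient_casimirScalar hS, principalSeries_casimirScalar _ _ hS.1, casimir_plus]

/-- Casimir scalar of `D_φ⁻`'s datum on its `K`-types: `κ − e²∕3`. [cite: Kovacevic2021, §3 Remark 3] -/
theorem dsCellDminus_casimirScalar {n m : ℤ} (hS : (n, m) ∈ (dsCellDminus a b c).S) :
    (dsCellDminus a b c).casimirScalar n m = (casimirOf a b c : ℂ) - ((centralOf a b c : ℤ) : ℂ) ^ 2 / 3 := by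
  rw [dsCellDminus, subquotient_S] at hS
  rw [dsCellDminus, subquotient_casimirScalar hS, principalSeries_casimirScalar _ _ hS.1, casimir_minus]

/-- **The Casimir scalar of every cell on every `K`-type is `κ₀ = κ − e²∕3`** (`κ = casimirOf a b c = a²+b²+c²−2`, `e = centralOf a b c = a+b+c`): the Casimir of
the ambient `V(c_K, 2t)` is `4c_K + 2t²∕3` (★ `casimir_principalSeries`), subquotients do not change it (★ `subquotient_casimirScalar`), and ★ `casimir_plus∕minus`.
After the tier-1 twist by `e∕3 · tr` this is the `(κ, e)`-pin of ★ `HasChiScalars` (row U8-4). [cite: Kovacevic2021, §3 Remark 3] [cite: BorelWallach2000, VI §4 4.10] -/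
theorem dsCellDatum_casimirScalar (j : Fin 3) {n m : ℤ} (hS : (n, m) ∈ (dsCellDatum j a b c).S) :
    (dsCellDatum j a b c).casimirScalar n m = (casimirOf a b c : ℂ) - ((centralOf a b c : ℤ) : ℂ) ^ 2 / 3 := by
  fin_cases j
  · exact dsCellD_casimirScalar hS
  · exact dsCellDplus_casimirScalar hS
  · exact dsCellDminus_casimirScalar hS

/-- The REDUCED Casimir eigenvalue (★ `casimir_vec_reduced`: only the gauge-invariant products `A D′`, `B C′` enter) of a subquotient of `V(c,2t)` on each of
its `K`-types is `4c + 2t²∕3` (★ `casimir_principalSeries`, ★ `subquotient_AD∕BC`). [cite: Kovacevic2021, §3 Remark 3, Remark 6] -/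
theorem subquotient_principalSeries_reducedCasimir (c₀ : ℂ) (t : ℤ)
    (N₁ N₂ : LieSubmodule ℂ (Matrix (Fin 3) (Fin 3) ℂ) (principalSeries c₀ t).V) {n m : ℤ}
    (hS : (n, m) ∈ ((principalSeries c₀ t).subquotient N₁ N₂).S) :
    ((n : ℂ) - 1) * ((n : ℂ) + 3) / 2 + (m : ℂ) ^ 2 / 6
        + 2 * (n : ℂ) * (((principalSeries c₀ t).subquotient N₁ N₂).A n m * ((principalSeries c₀ t).subquotient N₁ N₂).D (n + 1) (m + 3)
          + ((principalSeries c₀ t).subquotient N₁ N₂).B n m * ((principalSeries c₀ t).subquotient N₁ N₂).C (n + 1) (m - 3)) =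
      4 * c₀ + 2 * (t : ℂ) ^ 2 / 3 := by
  rw [subquotient_S] at hS
  rw [subquotient_AD hS, subquotient_BC hS]
  have hv := (principalSeries c₀ t).vec_ne_zero ⟨hS.1, le_rfl, (principalSeries c₀ t).one_le_of_mem hS.1⟩
  have h1 := (principalSeries c₀ t).casimir_vec_reduced n m 1
  rw [casimir_principalSeries, LinearMap.smul_apply, Module.End.one_apply] at h1
  exact (smul_left_injective ℂ hv h1).symm

/-- **The Casimir OPERATOR of every cell datum is the scalar `κ₀ = κ − e²∕3`** (`(dsCellDatum j a b c).casimir = κ₀ • 1`, ★ `casimir_eq_smul_one`) — the form the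
χ-pin patterns consume (cf. ★ `casimir_holDS : holDS.casimir = 0` at `φ = ρ`, where `κ₀ = 0`). [cite: Kovacevic2021, §3 Remark 3] [cite: Rogawski1990, §12.3 p. 177] -/
theorem dsCellDatum_casimir (j : Fin 3) :
    (dsCellDatum j a b c).casimir =
      ((casimirOf a b c : ℂ) - ((centralOf a b c : ℤ) : ℂ) ^ 2 / 3) • (1 : Module.End ℂ (dsCellDatum j a b c).V) := by
  have h0 : (dsCellD a b c).casimir = ((casimirOf a b c : ℂ) - ((centralOf a b c : ℤ) : ℂ) ^ 2 / 3) • (1 : Module.End ℂ (dsCellD a b c).V) := by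
    rw [← casimir_plus a b c]
    exact casimir_eq_smul_one _ fun n m hS => subquotient_principalSeries_reducedCasimir _ _ _ _ hS
  have h1 : (dsCellDplus a b c).casimir =
      ((casimirOf a b c : ℂ) - ((centralOf a b c : ℤ) : ℂ) ^ 2 / 3) • (1 : Module.End ℂ (dsCellDplus a b c).V) := by
    rw [← casimir_plus a b c]
    exact casimir_eq_smul_one _ fun n m hS => subquotient_principalSeries_reducedCasimir _ _ _ _ hS
  have h2 : (dsCellDminus a b c).casimir =
      ((casimirOf a b c : ℂ) - ((centralOf a b c : ℤ) : ℂ) ^ 2 / 3) • (1 : Module.End ℂ (dsCellDminus a b c).V) := by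
    rw [← casimir_minus a b c]
    exact casimir_eq_smul_one _ fun n m hS => subquotient_principalSeries_reducedCasimir _ _ _ _ hS
  fin_cases j
  · exact h0
  · exact h1
  · exact h2

/-- **Integrality of the tier-1 twist on every cell**: `6 ∣ m − 3n + 3 + 2e` on the `K`-types (`= 6(a − q)` on the `(+)`-series, `= 6(c − q)` on the `(−)`-series),
so the twisted `K`-type exponents `a′ = (m−3n+3+2e)∕6` of ★ `kTypeMatTw` are integers. [cite: BorelWallach2000, VI §4 4.7–4.8] -/
theorem dsCellDatum_integral (h : IsRegularParam a b c) (j : Fin 3) {n m : ℤ} (hS : (n, m) ∈ (dsCellDatum j a b c).S) :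
    (6 : ℤ) ∣ m - 3 * n + 3 + 2 * centralOf a b c := by
  fin_cases j
  · obtain ⟨p, q, -, -, rfl, rfl, -⟩ := ((mem_dsCellDatum_S_iff h n m).1).1 hS
    exact ⟨a - q, by rw [twist_integral_plus]⟩
  · obtain ⟨p, q, -, -, rfl, rfl, -⟩ := ((mem_dsCellDatum_S_iff h n m).2.1).1 hS
    exact ⟨a - q, by rw [twist_integral_plus]⟩
  · obtain ⟨p, q, -, -, rfl, rfl, -⟩ := ((mem_dsCellDatum_S_iff h n m).2.2).1 hS
    exact ⟨c - q, by rw [twist_integral_minus]⟩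

end Regular

end Summit.HodgeConjecture.HodgeConjecture.Cruxes.H413.K2E1bDSCellData

end
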